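import Summits.QuantumFields.YangMills.Theorems.BalabanLadderUVSeamRecPolymerInfluence
import Summits.QuantumFields.YangMills.Theorems.BalabanLadderUVSeamRecCeilingsResponseCarriers
import HarnessLib

/-!
# Crux `UVSeamRec` (stmt-QuantumFields-20043), v5(α) stub `stub_responseMomentsOdd6` (RM): the POLYMER DATA of the tempered
# architecture, III — the large-field correction CARRIER of the (β) discharge architecture in D1's concrete currency:
# uniform bounds on the influence functional and the glue «quadratic carrier + influence ⇒ (RM)»

Helper file (`--supports stmt-QuantumFields-20043 --as helper`) of the unit `ym-20043-tempered-d1` (gen 1), sequel of p531519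
`…PolymerData.lean` / p533172 `…PolymerInfluence.lean` (chart, `blockField`, `Polymer`, `influenceCoeff = (b^k/dist)⁴`, `shell`,
`largeFieldEvent`, `influence`, `influenceAt`, `coeffMass`) and of ceilings-p2 g2's carriers press-button p535725
`…CeilingsResponseCarriers.lean` (`TemperedResponse.responseMoments_of_carriers`).  It executes owner ruling R86g (2)/(3) + R86h (3)
(ym-beyond INBOX 2026-08-27T12:49Z/13:03Z: «D1 REDEFINED: the multiscale large-field correction from your polymer data is the CORRECTION
term of the (β) architecture») on the side that is bookkeeping: the influence functional `influenceAt 𝔟 ε kmax` IS an admissible carrier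
of `responseMoments_of_carriers` (measurable, uniformly bounded for each `(β, R)`), so the two OPEN inputs of the owner's v6 design —
`stub_temperedResponse6` «background-field split `(R⁴/C₁)|kerE − p| ≤ A₀ + Q + LF` for every exterior» and `stub_expMomentOdd6` «doubled
joint exponential moments of the quadratic carrier `Q` and of `LF` under the torus Wilson state» — imply (RM) VERBATIM with
`LF := influenceAt 𝔟 ε kmax` and `B = A₀ + max(B_Q, B_I)` (`responseMoments_of_quadratic_and_influence`), hence `MomentBounds6`
(`momentBounds6_of_quadratic_and_influence`).  HONEST FRAMING: bookkeeping and composition only; the split (a Bałaban background-field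
expansion of the cube kernel), the Gaussian domination of the quadratic carrier and the multiscale rarity of large block fields under `μ_T`
are OPEN renormalisation-group statements, hypotheses here; the level-`0` instance of the `LF` half is discharged in the sibling file
`…PolymerCarrierLevelZero.lean`.  Nothing of E0′ is claimed; not a gap, not Clay.

CONTENTS.  §1 counting: the shell of the radius-`(R+1)` cube has at most `(kmax+1)·(4R+5)⁴·6` polymers (`card_shell_le`: a polymer is
determined by level, anchor and orientation; anchors lie in the sup-ball of radius `2R+2` around `x`), hence `coeffMass ≤ #shell/16`
(`coeffMass_le`) and `|influenceAt| ≤ #shell/16` uniformly in the centre and the exterior (`abs_influenceAt_le_influenceBound`);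
at level `0` the sharper, `R`-UNIFORM budget `coeffMass 𝔟 0 R x ≤ 1536` (`coeffMass_zero_le`: `6(4R+5)⁴` polymers of coefficient
`≤ (R+4)⁻⁴`).  §2 the glue `responseMoments_of_quadratic_and_influence` / `momentBounds6_of_quadratic_and_influence` (ceilings-p2's
`responseMoments_of_carriers` at `K = 2`, carriers `![Q, influenceAt 𝔟 ε kmax]`; AM–GM, no Hölder, no rate).

LOCATED REMARK (for the v6 typist; refines g0's «periodic-folding caveat», V5-README): the polymer law (PL) of p528131/p535725 §2 asks the
product bound for ALL sub-families of ONE repetition-free polymer system per torus.  D1's polymers live on the GLOBAL block lattices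
`b^k ℤ⁴`, which descend to the odd torus `(ℤ/(2L+1))⁴` only when `b^k ∣ 2L+1`; for `k ≥ 1` on a general odd side the shells of two cubes that
are close ACROSS the period carry incompatible block lattices, i.e. distinct heavily-overlapping block plaquettes, for which a product law with
Peierls weights is not of Bałaban's kind.  Hence this file keeps the large-field half as the joint-moment hypothesis (EM_I) (true-or-false
exactly as the rarity of N20's block events under `μ_T`), and derives it from a product law only at level `0` (sibling file), where the
lattice is `ℤ⁴` itself and folds to every odd torus.  A multiscale (PL) on prime tori wants cube-centred block lattices and an
overlap-tolerant product law — the owner's pen.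

References: folklore (finite Jensen); H.-O. Georgii, *Gibbs Measures and Phase Transitions* (2011) Thm. 4.17 (DLR part, via p530862/p532025);
T. Bałaban, Commun. Math. Phys. 122 (1989) 355–392, (1.79)–(1.89) (the intended supplier of (EM_I)).
-/

set_option autoImplicit false

noncomputable section

open MeasureTheory Filter Topology Finset
open Literature.MathematicalPhysics.QuantumFieldTheory (GaugeConfig LatticeRep)
open Literature.MathematicalPhysics.QuantumLattice (LGConfig torusLift)
open Summit.QuantumFields.YangMills.Cruxes.OSLegsFromFemtoAndGap.DlrCollarTransfer
open Summit.QuantumFields.YangMills.Cruxes.UVSeamRec.TemperedResponse (responseMoments_of_carriers)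

namespace Summit.QuantumFields.YangMills.Cruxes.UVSeamRec.PolymerData

/-! ## §1 Counting the shell; uniform bounds on the influence functional -/

section Counting

/-- The sup-ball of radius `D` around `x` in `ℤ⁴` — the `piFinset` of the coordinate intervals `[x i − D, x i + D]` — has `(2D+1)⁴`
sites. [folklore] -/
theorem card_anchorBox (D : ℕ) (x : Fin 4 → ℤ) :
    (Fintype.piFinset fun i => Finset.Icc (x i - D) (x i + D)).card = (2 * D + 1) ^ 4 := by
  rw [Fintype.card_piFinset]
  have h : ∀ i, (Finset.Icc (x i - D) (x i + D)).card = 2 * D + 1 := fun i => by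
    rw [Int.card_Icc]
    have : x i + (D : ℤ) + 1 - (x i - D) = ((2 * D + 1 : ℕ) : ℤ) := by push_cast; ring
    rw [this, Int.toNat_natCast]
  simp_rw [h, Finset.prod_const, Finset.card_univ, Fintype.card_fin]

/-- A site within sup-distance `D` of `x` lies in the sup-ball of radius `D` around `x`. [folklore] -/
theorem mem_anchorBox_of_supDist_le {D : ℕ} {x z : Fin 4 → ℤ} (h : supDist x z ≤ D) :
    z ∈ Fintype.piFinset fun i => Finset.Icc (x i - D) (x i + D) := by
  rw [Fintype.mem_piFinset]
  intro i
  rw [Finset.mem_Icc]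
  have hi : ((x i - z i).natAbs : ℤ) ≤ (D : ℤ) := by exact_mod_cast (natAbs_sub_le_supDist x z i).trans h
  rw [Int.natCast_natAbs] at hi
  constructor
  · linarith [(abs_le.1 hi).2]
  · linarith [(abs_le.1 hi).1]

/-- A polymer is determined by its key (level, anchor, orientation) — `b^k ≠ 0`. [folklore] -/
theorem shellKey_injective (𝔟 : BlockSize) :
    Function.Injective fun γ : Polymer =>
      ((γ.k, anchor 𝔟 γ, ⟨(γ.μ, γ.ν), γ.hμν⟩) : ℕ × (Fin 4 → ℤ) × {q : Fin 4 × Fin 4 // q.1 < q.2}) := by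
  rintro ⟨k, y, μ, ν, h⟩ ⟨k', y', μ', ν', h'⟩ hkk
  simp only [Prod.mk.injEq, Subtype.mk.injEq] at hkk
  obtain ⟨rfl, ha, rfl, rfl⟩ := hkk
  have hy : y = y' := by
    funext i
    have hi := congr_fun ha i
    simp only [anchor] at hi
    have hb : ((𝔟.b : ℤ) ^ k) ≠ 0 := pow_ne_zero _ (by exact_mod_cast 𝔟.pos.ne')
    exact mul_left_cancel₀ hb hi
  subst hy
  rfl

/-- **The shell is finite, uniformly in the centre**: `#shell 𝔟 kmax R x ≤ (kmax+1)·(4R+5)⁴·6`. [folklore] -/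
theorem card_shell_le (𝔟 : BlockSize) (kmax R : ℕ) (x : Fin 4 → ℤ) :
    (shell 𝔟 kmax R x).card ≤ (kmax + 1) * (4 * R + 5) ^ 4 * 6 := by
  classical
  have hor : Fintype.card {q : Fin 4 × Fin 4 // q.1 < q.2} = 6 := by decide
  set key : Polymer → ℕ × (Fin 4 → ℤ) × {q : Fin 4 × Fin 4 // q.1 < q.2} :=
    fun γ => (γ.k, anchor 𝔟 γ, ⟨(γ.μ, γ.ν), γ.hμν⟩) with hkey
  have hmaps : ∀ γ ∈ shell 𝔟 kmax R x,
      key γ ∈ Finset.range (kmax + 1) ×ˢ (Fintype.piFinset fun i => Finset.Icc (x i - (2 * R + 2 : ℕ)) (x i + (2 * R + 2 : ℕ))) ×ˢ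
        (Finset.univ : Finset {q : Fin 4 × Fin 4 // q.1 < q.2}) := by
    intro γ hγ
    simp only [hkey, Finset.mem_product, Finset.mem_range, Finset.mem_univ, and_true]
    exact ⟨Nat.lt_succ_of_le (level_le_of_mem_shell hγ), mem_anchorBox_of_supDist_le (supDist_le_of_mem_shell hγ)⟩
  calc (shell 𝔟 kmax R x).card
      ≤ (Finset.range (kmax + 1) ×ˢ (Fintype.piFinset fun i => Finset.Icc (x i - (2 * R + 2 : ℕ)) (x i + (2 * R + 2 : ℕ))) ×ˢ
          (Finset.univ : Finset {q : Fin 4 × Fin 4 // q.1 < q.2})).card :=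
        Finset.card_le_card_of_injOn key hmaps ((shellKey_injective 𝔟).injOn)
    _ = (kmax + 1) * (4 * R + 5) ^ 4 * 6 := by
        rw [Finset.card_product, Finset.card_product, Finset.card_range, card_anchorBox, Finset.card_univ, hor]
        ring_nf

/-- **The coefficient mass is bounded uniformly in the centre**: `coeffMass 𝔟 kmax R x ≤ (kmax+1)·(4R+5)⁴·6 / 16` (each shell
coefficient is `≤ 1/16`). [folklore] -/
theorem coeffMass_le (𝔟 : BlockSize) (kmax R : ℕ) (x : Fin 4 → ℤ) :
    coeffMass 𝔟 kmax R x ≤ (((kmax + 1) * (4 * R + 5) ^ 4 * 6 : ℕ) : ℝ) / 16 := by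
  unfold coeffMass
  calc ∑ γ ∈ shell 𝔟 kmax R x, influenceCoeff 𝔟 γ x ≤ ∑ _γ ∈ shell 𝔟 kmax R x, (1 / 16 : ℝ) :=
        Finset.sum_le_sum fun γ hγ => influenceCoeff_le_of_mem_shell hγ
    _ = ((shell 𝔟 kmax R x).card : ℝ) * (1 / 16) := by rw [Finset.sum_const, nsmul_eq_mul]
    _ ≤ (((kmax + 1) * (4 * R + 5) ^ 4 * 6 : ℕ) : ℝ) * (1 / 16) := by
        gcongr
        exact_mod_cast card_shell_le 𝔟 kmax R x
    _ = (((kmax + 1) * (4 * R + 5) ^ 4 * 6 : ℕ) : ℝ) / 16 := by ring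

/-- **`|influenceAt 𝔟 ε kmax β R q x η| ≤ (kmax β R + 1)·(4R+5)⁴·6 / 16` for every centre and exterior** — the uniform bound
`MY β R` that ceilings-p2's `responseMoments_of_carriers` asks of a carrier (hypothesis `hYb`). [folklore] -/
theorem abs_influenceAt_le_influenceBound {N : ℕ} [NeZero N] (𝔟 : BlockSize) (ε : ℝ → ℕ → ℝ) (kmax : ℝ → ℕ → ℕ)
    (β : ℝ) (R : ℕ) (q : Fin 4 × Fin 4) (x : Fin 4 → ℤ) (η : LGConfig 4 (Matrix.specialUnitaryGroup (Fin N) ℂ)) :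
    |influenceAt (N := N) 𝔟 ε kmax β R q x η| ≤ (((kmax β R + 1) * (4 * R + 5) ^ 4 * 6 : ℕ) : ℝ) / 16 :=
  (abs_influenceAt_le 𝔟 ε kmax β R q x η).trans (coeffMass_le 𝔟 (kmax β R) R x)

/-- At level `0` a shell coefficient is `≤ (R+4)⁻⁴` (`dist ≥ R + 2 + 2·b⁰ = R + 4`, `b⁰ = 1`). [folklore] -/
theorem influenceCoeff_le_of_mem_shell_zero {𝔟 : BlockSize} {R : ℕ} {x : Fin 4 → ℤ} {γ : Polymer}
    (h : γ ∈ shell 𝔟 0 R x) : influenceCoeff 𝔟 γ x ≤ 1 / ((R : ℝ) + 4) ^ 4 := by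
  have hk : γ.k = 0 := Nat.le_zero.1 (level_le_of_mem_shell h)
  have hd := le_supDist_of_mem_shell h
  rw [hk, pow_zero, mul_one] at hd
  have hd' : (R : ℝ) + 4 ≤ (supDist x (anchor 𝔟 γ) : ℝ) := by
    have : ((R + 2 + 2 : ℕ) : ℝ) ≤ (supDist x (anchor 𝔟 γ) : ℝ) := by exact_mod_cast hd
    push_cast at this
    linarith
  have hR4 : (0 : ℝ) < (R : ℝ) + 4 := by positivity
  unfold influenceCoeff
  rw [hk, pow_zero, div_pow, one_pow]
  exact one_div_le_one_div_of_le (pow_pos hR4 4) (pow_le_pow_left₀ hR4.le hd' 4)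

/-- **The level-`0` coefficient mass is bounded UNIFORMLY IN `R`**: `coeffMass 𝔟 0 R x ≤ 1536 = 6·4⁴` (`6(4R+5)⁴` polymers of
coefficient `≤ (R+4)⁻⁴`, and `4R+5 ≤ 4(R+4)`) — the density budget of the level-`0` large-field carrier is scale-free. [folklore] -/
theorem coeffMass_zero_le (𝔟 : BlockSize) (R : ℕ) (x : Fin 4 → ℤ) : coeffMass 𝔟 0 R x ≤ 1536 := by
  have hR4 : (0 : ℝ) < (R : ℝ) + 4 := by positivity
  have hcard : ((shell 𝔟 0 R x).card : ℝ) ≤ (4 * (R : ℝ) + 5) ^ 4 * 6 := by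
    have h := card_shell_le 𝔟 0 R x
    have h' : ((shell 𝔟 0 R x).card : ℝ) ≤ (((0 + 1) * (4 * R + 5) ^ 4 * 6 : ℕ) : ℝ) := by exact_mod_cast h
    simpa using h'
  unfold coeffMass
  calc ∑ γ ∈ shell 𝔟 0 R x, influenceCoeff 𝔟 γ x ≤ ∑ _γ ∈ shell 𝔟 0 R x, 1 / ((R : ℝ) + 4) ^ 4 :=
        Finset.sum_le_sum fun γ hγ => influenceCoeff_le_of_mem_shell_zero hγ
    _ = ((shell 𝔟 0 R x).card : ℝ) * (1 / ((R : ℝ) + 4) ^ 4) := by rw [Finset.sum_const, nsmul_eq_mul]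
    _ ≤ (4 * (R : ℝ) + 5) ^ 4 * 6 * (1 / ((R : ℝ) + 4) ^ 4) :=
        mul_le_mul_of_nonneg_right hcard (by positivity)
    _ = 6 * ((4 * (R : ℝ) + 5) / ((R : ℝ) + 4)) ^ 4 := by
        rw [div_pow]; ring
    _ ≤ 6 * (4 : ℝ) ^ 4 := by
        have hq : (4 * (R : ℝ) + 5) / ((R : ℝ) + 4) ≤ 4 := by
          rw [div_le_iff₀ hR4]; linarith
        have hq0 : 0 ≤ (4 * (R : ℝ) + 5) / ((R : ℝ) + 4) := by positivity
        gcongr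
    _ = 1536 := by norm_num

/-- `0 ≤ influence ≤ 1536` at level `0`, for every block size, thresholds, radius, centre and exterior. [folklore] -/
theorem influence_zero_le {N : ℕ} [NeZero N] (𝔟 : BlockSize) (ε : ℕ → ℝ) (R : ℕ) (x : Fin 4 → ℤ)
    (η : LGConfig 4 (Matrix.specialUnitaryGroup (Fin N) ℂ)) : influence (N := N) 𝔟 ε 0 R x η ≤ 1536 :=
  (influence_le_coeffMass 𝔟 ε 0 R x η).trans (coeffMass_zero_le 𝔟 R x)

end Counting

/-! ## §2 The glue: quadratic carrier + influence functional ⇒ (RM) -/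

section Glue

variable {N : ℕ} [NeZero N] (r : LatticeRep (Matrix.specialUnitaryGroup (Fin N) ℂ)) (a : ℝ → ℝ)

/-- **(RM) FROM THE (β) ARCHITECTURE IN D1's CURRENCY — quadratic carrier + multiscale large-field influence.**  Data: a measurable
«quadratic» carrier `Q β R q x : LGConfig 4 SU(N) → ℝ` of the cube exterior (`|Q| ≤ MQ β R`; the owner's `βR⁴|F_harm|²/C₁`-type boundary-flux
carrier), the tempering data of `…PolymerData` — block size `𝔟`, per-level thresholds `ε β k`, level cutoff `kmax β R` — constants `C₁`,
`A₀`, `B_Q`, `B_I`, `β₁`, `ℓ₁`, reference values `p`, any lattice representation `r` of `SU(N)` for the kernels and the torus state.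
Hypotheses — the owner's v6 stub texts (R86g (2)): (split) «`stub_temperedResponse6`» for `β ≥ β₁`, `1 ≤ R`, `R·a β ≤ ℓ₁`, `q.1 < q.2` and EVERY
exterior `η`, `(R⁴/C₁)|kerE_{x−(R+1),2R+3}(plane q x)(η) − p q β| ≤ A₀ + Q β R q x η + influenceAt 𝔟 ε kmax β R q x η`; (EM_Q) ∧ (EM_I)
«`stub_expMomentOdd6`»: on every odd torus `(ℤ/(2L+1))⁴` with `4R+8 ≤ L`, for every cyclically `2R+4`-separated family and index set `T`, the
DOUBLED joint exponential moments `⟨exp(2Σ_{i∈T} Q_i∘lift)⟩_{2L+1,β} ≤ e^{B_Q·#T}` and `⟨exp(2Σ_{i∈T} influenceAt_i∘lift)⟩_{2L+1,β} ≤ e^{B_I·#T}`.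
THEN (RM) VERBATIM (the hypothesis `hRM` of p532025 `momentBounds6_of_responseMoments`) with `B = A₀ + max(B_Q, B_I)` — ceilings-p2's
`responseMoments_of_carriers` at `K = 2` with the carriers `![Q, influenceAt 𝔟 ε kmax]`; the influence half's measurability and uniform
bound are D1's (`measurable_influenceAt`, `abs_influenceAt_le_influenceBound`).  No Hölder, no rate, no reflection positivity, no
divisibility of the side. [folklore] -/
theorem responseMoments_of_quadratic_and_influence {C₁ β₁ ℓ₁ A₀ B_Q B_I : ℝ} {p : Fin 4 × Fin 4 → ℝ → ℝ}
    (Q : ℝ → ℕ → Fin 4 × Fin 4 → (Fin 4 → ℤ) → LGConfig 4 (Matrix.specialUnitaryGroup (Fin N) ℂ) → ℝ) (MQ : ℝ → ℕ → ℝ)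
    (hQm : ∀ β R q x, Measurable (Q β R q x)) (hQb : ∀ β R q x η, |Q β R q x η| ≤ MQ β R)
    (𝔟 : BlockSize) (ε : ℝ → ℕ → ℝ) (kmax : ℝ → ℕ → ℕ)
    (hsplit : ∀ β : ℝ, β₁ ≤ β → ∀ R : ℕ, 1 ≤ R → (R : ℝ) * a β ≤ ℓ₁ →
      ∀ (q : Fin 4 × Fin 4) (x : Fin 4 → ℤ), q.1 < q.2 → ∀ η : LGConfig 4 (Matrix.specialUnitaryGroup (Fin N) ℂ),
        (R : ℝ) ^ 4 / C₁ * |kerE (Matrix.specialUnitaryGroup (Fin N) ℂ) r β (fun k => x k - (R + 1)) (2 * R + 3) η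
          (plane (Matrix.specialUnitaryGroup (Fin N) ℂ) r q x) - p q β| ≤
          A₀ + Q β R q x η + influenceAt (N := N) 𝔟 ε kmax β R q x η)
    (hEMQ : ∀ β : ℝ, β₁ ≤ β → ∀ (L n : ℕ) (q : Fin n → Fin 4 × Fin 4) (x : Fin n → (Fin 4 → ℤ)) (R : ℕ),
      (∀ i, (q i).1 < (q i).2) → 1 ≤ R → (R : ℝ) * a β ≤ ℓ₁ → 4 * R + 8 ≤ L →
      (∀ i j : Fin n, i ≠ j → ∃ k : Fin 4,
        (2 * (R : ℤ) + 4) ≤ |((((x i k - x j k : ℤ) : ZMod (2 * L + 1))).valMinAbs : ℤ)|) →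
      ∀ T : Finset (Fin n),
        torusE (Matrix.specialUnitaryGroup (Fin N) ℂ) r β L
          (fun U => Real.exp (((2 : ℕ) : ℝ) * ∑ i ∈ T, Q β R (q i) (x i) U)) ≤ Real.exp (B_Q * T.card))
    (hEMI : ∀ β : ℝ, β₁ ≤ β → ∀ (L n : ℕ) (q : Fin n → Fin 4 × Fin 4) (x : Fin n → (Fin 4 → ℤ)) (R : ℕ),
      (∀ i, (q i).1 < (q i).2) → 1 ≤ R → (R : ℝ) * a β ≤ ℓ₁ → 4 * R + 8 ≤ L →
      (∀ i j : Fin n, i ≠ j → ∃ k : Fin 4,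
        (2 * (R : ℤ) + 4) ≤ |((((x i k - x j k : ℤ) : ZMod (2 * L + 1))).valMinAbs : ℤ)|) →
      ∀ T : Finset (Fin n),
        torusE (Matrix.specialUnitaryGroup (Fin N) ℂ) r β L
          (fun U => Real.exp (((2 : ℕ) : ℝ) * ∑ i ∈ T, influenceAt (N := N) 𝔟 ε kmax β R (q i) (x i) U)) ≤
          Real.exp (B_I * T.card)) :
    ∀ β : ℝ, β₁ ≤ β → ∀ (L n : ℕ) (q : Fin n → Fin 4 × Fin 4) (x : Fin n → (Fin 4 → ℤ)) (R : ℕ),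
      (∀ i, (q i).1 < (q i).2) → 1 ≤ R → (R : ℝ) * a β ≤ ℓ₁ → 4 * R + 8 ≤ L →
      (∀ i j : Fin n, i ≠ j → ∃ k : Fin 4,
        (2 * (R : ℤ) + 4) ≤ |((((x i k - x j k : ℤ) : ZMod (2 * L + 1))).valMinAbs : ℤ)|) →
      ∀ T : Finset (Fin n),
        torusE (Matrix.specialUnitaryGroup (Fin N) ℂ) r β L (fun U => Real.exp (∑ i ∈ T, (R : ℝ) ^ 4 / C₁ *
          |kerE (Matrix.specialUnitaryGroup (Fin N) ℂ) r β (fun k => x i k - (R + 1)) (2 * R + 3) U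
            (plane (Matrix.specialUnitaryGroup (Fin N) ℂ) r (q i) (x i)) - p (q i) β|)) ≤
          Real.exp ((A₀ + max B_Q B_I) * T.card) := by
  -- the two carriers as a `Fin 2`-family
  set Y : Fin 2 → ℝ → ℕ → Fin 4 × Fin 4 → (Fin 4 → ℤ) → LGConfig 4 (Matrix.specialUnitaryGroup (Fin N) ℂ) → ℝ :=
    ![Q, influenceAt (N := N) 𝔟 ε kmax] with hYdef
  refine responseMoments_of_carriers r a (K := 2) (by norm_num) Y
    (fun β R => max (MQ β R) ((((kmax β R + 1) * (4 * R + 5) ^ 4 * 6 : ℕ) : ℝ) / 16)) ?_ ?_ ?_ ?_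
  · intro k β R q x
    fin_cases k
    · simpa [hYdef] using hQm β R q x
    · simpa [hYdef] using measurable_influenceAt (N := N) 𝔟 ε kmax β R q x
  · intro k β R q x η
    fin_cases k
    · simpa [hYdef] using (hQb β R q x η).trans (le_max_left _ _)
    · simpa [hYdef] using (abs_influenceAt_le_influenceBound (N := N) 𝔟 ε kmax β R q x η).trans (le_max_right _ _)
  · intro β hβ R hR hRa q x hq η
    have h := hsplit β hβ R hR hRa q x hq η
    simpa [hYdef, Fin.sum_univ_two, add_assoc] using h
  · intro k β hβ L n q x R hq hR hRa hRL hsep T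
    fin_cases k
    · have h := hEMQ β hβ L n q x R hq hR hRa hRL hsep T
      refine (le_of_eq ?_).trans (h.trans (Real.exp_le_exp.2 ?_))
      · simp [hYdef]
      · exact mul_le_mul_of_nonneg_right (le_max_left _ _) (Nat.cast_nonneg _)
    · have h := hEMI β hβ L n q x R hq hR hRa hRL hsep T
      refine (le_of_eq ?_).trans (h.trans (Real.exp_le_exp.2 ?_))
      · simp [hYdef]
      · exact mul_le_mul_of_nonneg_right (le_max_right _ _) (Nat.cast_nonneg _)

/-- **`MomentBounds6 SU(N) r a` from the (β) architecture in D1's currency** — `responseMoments_of_quadratic_and_influence` ⊕ p532025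
`momentBounds6_of_responseMoments`; constant `C = C₁(2 + e^{B})e^{B}`, `B = A₀ + max(B_Q, B_I)`; all odd sides.
[folklore: Georgii (2011) Thm. 4.17 for the DLR part] -/
theorem momentBounds6_of_quadratic_and_influence {C₁ β₁ ℓ₁ A₀ B_Q B_I P₀ : ℝ} {p : Fin 4 × Fin 4 → ℝ → ℝ}
    (hℓ₁ : 0 < ℓ₁) (hC₁ : 0 < C₁) (hp : ∀ q β, |p q β| ≤ P₀)
    (Q : ℝ → ℕ → Fin 4 × Fin 4 → (Fin 4 → ℤ) → LGConfig 4 (Matrix.specialUnitaryGroup (Fin N) ℂ) → ℝ) (MQ : ℝ → ℕ → ℝ)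
    (hQm : ∀ β R q x, Measurable (Q β R q x)) (hQb : ∀ β R q x η, |Q β R q x η| ≤ MQ β R)
    (𝔟 : BlockSize) (ε : ℝ → ℕ → ℝ) (kmax : ℝ → ℕ → ℕ)
    (hsplit : ∀ β : ℝ, β₁ ≤ β → ∀ R : ℕ, 1 ≤ R → (R : ℝ) * a β ≤ ℓ₁ →
      ∀ (q : Fin 4 × Fin 4) (x : Fin 4 → ℤ), q.1 < q.2 → ∀ η : LGConfig 4 (Matrix.specialUnitaryGroup (Fin N) ℂ),
        (R : ℝ) ^ 4 / C₁ * |kerE (Matrix.specialUnitaryGroup (Fin N) ℂ) r β (fun k => x k - (R + 1)) (2 * R + 3) η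
          (plane (Matrix.specialUnitaryGroup (Fin N) ℂ) r q x) - p q β| ≤
          A₀ + Q β R q x η + influenceAt (N := N) 𝔟 ε kmax β R q x η)
    (hEMQ : ∀ β : ℝ, β₁ ≤ β → ∀ (L n : ℕ) (q : Fin n → Fin 4 × Fin 4) (x : Fin n → (Fin 4 → ℤ)) (R : ℕ),
      (∀ i, (q i).1 < (q i).2) → 1 ≤ R → (R : ℝ) * a β ≤ ℓ₁ → 4 * R + 8 ≤ L →
      (∀ i j : Fin n, i ≠ j → ∃ k : Fin 4,
        (2 * (R : ℤ) + 4) ≤ |((((x i k - x j k : ℤ) : ZMod (2 * L + 1))).valMinAbs : ℤ)|) →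
      ∀ T : Finset (Fin n),
        torusE (Matrix.specialUnitaryGroup (Fin N) ℂ) r β L
          (fun U => Real.exp (((2 : ℕ) : ℝ) * ∑ i ∈ T, Q β R (q i) (x i) U)) ≤ Real.exp (B_Q * T.card))
    (hEMI : ∀ β : ℝ, β₁ ≤ β → ∀ (L n : ℕ) (q : Fin n → Fin 4 × Fin 4) (x : Fin n → (Fin 4 → ℤ)) (R : ℕ),
      (∀ i, (q i).1 < (q i).2) → 1 ≤ R → (R : ℝ) * a β ≤ ℓ₁ → 4 * R + 8 ≤ L →
      (∀ i j : Fin n, i ≠ j → ∃ k : Fin 4,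
        (2 * (R : ℤ) + 4) ≤ |((((x i k - x j k : ℤ) : ZMod (2 * L + 1))).valMinAbs : ℤ)|) →
      ∀ T : Finset (Fin n),
        torusE (Matrix.specialUnitaryGroup (Fin N) ℂ) r β L
          (fun U => Real.exp (((2 : ℕ) : ℝ) * ∑ i ∈ T, influenceAt (N := N) 𝔟 ε kmax β R (q i) (x i) U)) ≤
          Real.exp (B_I * T.card)) :
    MomentBounds6 (Matrix.specialUnitaryGroup (Fin N) ℂ) r a :=
  Summit.QuantumFields.YangMills.Cruxes.UVSeamRec.TemperedResponse.momentBounds6_of_responseMoments r a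
    (B := A₀ + max B_Q B_I) hℓ₁ hC₁ hp
    (responseMoments_of_quadratic_and_influence r a Q MQ hQm hQb 𝔟 ε kmax hsplit hEMQ hEMI)

end Glue

end Summit.QuantumFields.YangMills.Cruxes.UVSeamRec.PolymerData

end
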